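import Summits.BirchSwinnertonDyer.BirchSwinnertonDyer.Theorems.AdditiveKolyvaginRoadLocalPackage
import Summits.BirchSwinnertonDyer.BirchSwinnertonDyer.Theorems.AdditiveKolyvaginRoadToricIsotropy
import Summits.BirchSwinnertonDyer.BirchSwinnertonDyer.Theorems.KolyvaginRoadThreeMethod2TriangulationOfKolyvaginLocal
import HarnessLib

/-!
# Route `AdditiveKolyvaginRoad`, crux `KolyvaginPrimitiveAdditive` (item stmt-BirchSwinnertonDyer-20132):
# stub LOC REDUCED — the local–global package `KolyvaginLocalPackageP` at a general prime `p` FROM the Kolyvagin-prime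
# local package + (Supply) ONLY: the local Tate forms, (REC), the Kummer isotropy and the TORIC isotropy above
# Bertolini–Darmon admissible primes SUPPLIED IN THE KERNEL
# (cell `pub/bsd-wall`, lead prover `bsd-wall-akr-p1` g3; `--supports stmt-BirchSwinnertonDyer-20132`, helper;
# p-generic port of §1 of zhang3-p1's `Theorems/KolyvaginRoadThreeMethod2TriangulationOfKolyvaginLocal.lean` with
# akr-p1 g2's toric isotropy `AdditiveKolyvaginRoadToricIsotropy` in place of koly g13's ordinary isotropy)

WHY THIS FILE. Stub LOC `stub_kolyvaginLocalPackageAdditive` of skeleton v7 of crux 20132 asks for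
`Nonempty (KolyvaginLocalPackageP W K p ι c)` (p527353) at every ♯ additive frame. Four of its eight fields are tree
mathematics at every prime: the local forms `b_v := inv_v ∘ (· ∪_e ·)` for a Weil pairing `e` on `E[p]`
(`exists_weilPairing_holds`) and the Poitou–Tate family `inv` of the totally complex `K` (tree THEOREM
`poitouTate_sum_localTatePairing_eq_zero_of_isTotallyComplex`), (REC) (`sum_inv_weilCupProduct_localization_eq_zero`,
Milne I Thm 4.10), the Kummer isotropy (`cupProduct_eq_zero_of_mem_kummerSelmerStructure_of_fact` with the DISCHARGED
Poonen–Rains fact `kummerClass_cupProduct_kummerClass_eq_zero_holds`), and the TORIC isotropy above every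
Bertolini–Darmon admissible prime (akr-p1 g2: `weilCupProduct_res_eq_zero_of_valued` + `weilPairingHom_eq_zero_of_mem_
of_card_le` + `natCard_augmentation_le_of_admQ` — the augmentation line has order `≤ p` since `Frob_q² ≠ 1`). This
file supplies them, so that stub LOC REDUCES to the KOLYVAGIN-PRIME local package in cup-product currency — (Tr-iso),
(Perf) for every Weil-type pairing, (Line) — plus (Supply) = W. Zhang's Lemma 8.2: exactly the inputs zhang3-p1 g9's
`Method2.triangulation_of_kolyvaginLocal` keeps at `p = 3` (and which the `p = 3` cell is discharging in
`…Method2Kolyvagin{TransverseIsotropy,Perf,Line,CupNonvanishing}` ∕ `…ZhangSupply*`).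

WHAT. §1 package lemmas (one declaration each): `exists_zmodBilinear_invCupProduct_P` (the local forms as
`ZMod p`-bilinear maps), `sum_invCupProduct_eq_zero_P` ((REC)), `invCupProduct_eq_zero_of_mem_kummer_P`,
`invCupProduct_eq_zero_of_mem_toric_P`. §2 `kolyvaginLocalPackageP_of_kolyvaginPrimePackage`: at `K` imaginary
quadratic, the Kolyvagin-prime package (∀ Weil-type `e`) + (Line) + (Supply) ⟹ `Nonempty (KolyvaginLocalPackageP …)`.
The compactness of the absolute Galois groups of the completions and the finiteness of `E[p](K̄)` (local instances
in the tree's cup-product files) are instance binders here (both are propositions).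

HONEST FRAMING: theorems only; 0 definitions, 0 named facts, 0 `sorry`; CONDITIONAL on the Kolyvagin-prime package and
(Supply); does NOT close stub LOC (it reduces it).

References: [cite: WZhang2014, §8.1, Lemma 8.1, Lemma 8.2, Prop. 5.4] [cite: MilneADT2006, Ch. I, Cor. 2.3, Thm. 4.10]
[cite: PoonenRains2012, Prop. 4.8, Cor. 4.6] [cite: BertoliniDarmon2005, §2.2–§2.3] [cite: CasselsFrohlichANT1967,
Ch. VII §11].
-/

-- single-conjunct summit: `Summit.BirchSwinnertonDyer.BirchSwinnertonDyer.…` repeats the name by design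
set_option linter.dupNamespace false

noncomputable section

open scoped Classical

namespace Summit.BirchSwinnertonDyer.BirchSwinnertonDyer.Theorems.AdditiveKoly

open CategoryTheory WeierstrassCurve NumberField IsDedekindDomain Field
  Literature.NumberTheory.EllipticCurves Literature.NumberTheory.EllipticCurves.ModularForms
  Literature.NumberTheory.GaloisRepresentations Module
open Literature.NumberTheory.GaloisRepresentations.DiscreteGaloisModule (mu MuCarrier)
open Literature.NumberTheory.GaloisCohomology
open Summit.BirchSwinnertonDyer.Rank1Residual.X11b.Three.Koly.Method2
open scoped ContRepresentation

variable (W : WeierstrassCurve ℚ) (K : Type) [Field K] [NumberField K] (p : ℕ)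
variable [W.IsElliptic] [W.IsGloballyMinimal] [Fact p.Prime] (ι : K →+* ℂ) (c : K ≃ₐ[ℚ] K)
  [∀ v : Place K, Module (ZMod p)
    (galoisCohomology (((W.baseChange K).torsionGaloisModule ((p ^ 1 : ℕ) : ℤ)).toLocal v) 1)]
  -- cup products need the compactness of the absolute Galois groups; the Tate dual needs `E[p](K̄)` finite
  [∀ v : Place K, CompactSpace (absoluteGaloisGroup (Place.Completion v))]
  [Finite (geomTorsion (W.baseChange K) ((p ^ 1 : ℕ) : ℤ))]

/-! ## §1 The package lemmas -/

section Package

variable (e : geomTorsion (W.baseChange K) ((p ^ 1 : ℕ) : ℤ) → geomTorsion (W.baseChange K) ((p ^ 1 : ℕ) : ℤ) →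
    AlgebraicClosure K)
  (hμ : ∀ P Q, e P Q ^ (p ^ 1) = 1) (hadd₁ : ∀ P₁ P₂ Q, e (P₁ + P₂) Q = e P₁ Q * e P₂ Q)
  (hadd₂ : ∀ P Q₁ Q₂, e P (Q₁ + Q₂) = e P Q₁ * e P Q₂)
  (hgal : ∀ (σ : absoluteGaloisGroup K) (P Q : geomTorsion (W.baseChange K) ((p ^ 1 : ℕ) : ℤ)),
    σ • e P Q = e (σ • P) (σ • Q))
  (inv : LocalInvariants K (p ^ 1))

omit [W.IsElliptic] [W.IsGloballyMinimal] [Finite (geomTorsion (W.baseChange K) ((p ^ 1 : ℕ) : ℤ))] in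
/-- **The local forms `b_v = inv_v ∘ (· ∪ₑ ·)` as `ZMod p`-bilinear maps** on `H¹(K_v, E[p])` (bi-additivity of the cup
product and of `inv_v`; any `ZMod p`-structures). Port of zhang3-p1's `exists_zmodBilinear_invCupProduct`.
[cite: MilneADT2006, Ch. I §2 (cup product pairing)] -/
theorem exists_zmodBilinear_invCupProduct_P :
    ∃ b : (v : Place K) →
      galoisCohomology (((W.baseChange K).torsionGaloisModule ((p ^ 1 : ℕ) : ℤ)).toLocal v) 1 →ₗ[ZMod p]
          galoisCohomology (((W.baseChange K).torsionGaloisModule ((p ^ 1 : ℕ) : ℤ)).toLocal v) 1 →ₗ[ZMod p] ZMod p,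
      ∀ (v : Place K) x y,
        b v x y = ZMod.ringEquivCongr (pow_one p)
          (inv v ((weilContPairingLocal (W.baseChange K) (p ^ 1) e hμ hadd₁ hadd₂ hgal v).cupProduct x y)) := by
  haveI : NeZero p := ⟨(Fact.out : p.Prime).ne_zero⟩
  -- a `ZMod p`-multiple is the corresponding natural multiple (any `ZMod p`-module structure)
  have hzmod : ∀ {M : Type} [AddCommGroup M] [Module (ZMod p) M] (a : ZMod p) (x : M), a • x = a.val • x := by
    intro M _ _ a x
    conv_lhs => rw [← ZMod.natCast_zmod_val a]
    rw [Nat.cast_smul_eq_nsmul]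
  -- bi-additivity of `(x, y) ↦ inv_v (x ∪ₑ y)`
  have hadd_left : ∀ (v : Place K) (x x' y : galoisCohomology (((W.baseChange K).torsionGaloisModule ((p ^ 1 : ℕ) :
      ℤ)).toLocal v) 1),
      (weilContPairingLocal (W.baseChange K) (p ^ 1) e hμ hadd₁ hadd₂ hgal v).cupProduct (x + x' : galoisCohomology
          (((W.baseChange K).torsionGaloisModule ((p ^ 1 : ℕ) : ℤ)).toLocal v) 1) y =
        (weilContPairingLocal (W.baseChange K) (p ^ 1) e hμ hadd₁ hadd₂ hgal v).cupProduct x y +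
            (weilContPairingLocal (W.baseChange K) (p ^ 1) e hμ hadd₁ hadd₂ hgal v).cupProduct x' y :=
    fun v x x' y ↦ (congrArg (fun f ↦ f y) (map_add (weilContPairingLocal (W.baseChange K) (p ^ 1) e hμ hadd₁ hadd₂
        hgal v).cupProduct x x')).trans (LinearMap.add_apply _ _ _)
  have hadd_right : ∀ (v : Place K) (x y y' : galoisCohomology (((W.baseChange K).torsionGaloisModule ((p ^ 1 : ℕ)
      : ℤ)).toLocal v) 1),
      (weilContPairingLocal (W.baseChange K) (p ^ 1) e hμ hadd₁ hadd₂ hgal v).cupProduct x (y + y' :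
          galoisCohomology (((W.baseChange K).torsionGaloisModule ((p ^ 1 : ℕ) : ℤ)).toLocal v) 1) =
        (weilContPairingLocal (W.baseChange K) (p ^ 1) e hμ hadd₁ hadd₂ hgal v).cupProduct x y +
            (weilContPairingLocal (W.baseChange K) (p ^ 1) e hμ hadd₁ hadd₂ hgal v).cupProduct x y' :=
    fun v x y y' ↦ map_add ((weilContPairingLocal (W.baseChange K) (p ^ 1) e hμ hadd₁ hadd₂ hgal v).cupProduct x) y y'
  have hnsmul_left : ∀ (v : Place K) (k : ℕ) (x y : galoisCohomology (((W.baseChange K).torsionGaloisModule ((p ^ 1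
      : ℕ) : ℤ)).toLocal v) 1),
      (weilContPairingLocal (W.baseChange K) (p ^ 1) e hμ hadd₁ hadd₂ hgal v).cupProduct (k • x : galoisCohomology
          (((W.baseChange K).torsionGaloisModule ((p ^ 1 : ℕ) : ℤ)).toLocal v) 1) y = k • (weilContPairingLocal
          (W.baseChange K) (p ^ 1) e hμ hadd₁ hadd₂ hgal v).cupProduct x y := fun v k x y ↦ by
    induction k with
    | zero =>
      rw [zero_nsmul, zero_nsmul]
      have h := hadd_left v 0 0 y
      rw [add_zero] at h
      exact add_left_cancel (h.symm.trans (add_zero _).symm)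
    | succ k ih => rw [succ_nsmul, succ_nsmul, hadd_left, ih]
  have hnsmul_right : ∀ (v : Place K) (k : ℕ) (x y : galoisCohomology (((W.baseChange K).torsionGaloisModule ((p ^
      1 : ℕ) : ℤ)).toLocal v) 1),
      (weilContPairingLocal (W.baseChange K) (p ^ 1) e hμ hadd₁ hadd₂ hgal v).cupProduct x (k • y :
          galoisCohomology (((W.baseChange K).torsionGaloisModule ((p ^ 1 : ℕ) : ℤ)).toLocal v) 1) = k •
          (weilContPairingLocal (W.baseChange K) (p ^ 1) e hμ hadd₁ hadd₂ hgal v).cupProduct x y := fun v k x y ↦ by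
    induction k with
    | zero =>
      rw [zero_nsmul, zero_nsmul]
      have h := hadd_right v x 0 0
      rw [add_zero] at h
      exact add_left_cancel (h.symm.trans (add_zero _).symm)
    | succ k ih => rw [succ_nsmul, succ_nsmul, hadd_right, ih]
  -- the local form at `v`, transported from `ZMod (p ^ 1)` to `ZMod p`
  let β : (v : Place K) → galoisCohomology (((W.baseChange K).torsionGaloisModule ((p ^ 1 : ℕ) : ℤ)).toLocal v) 1 →
      galoisCohomology (((W.baseChange K).torsionGaloisModule ((p ^ 1 : ℕ) : ℤ)).toLocal v) 1 → ZMod p :=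
    fun v x y ↦ ZMod.ringEquivCongr (pow_one p)
      (inv v ((weilContPairingLocal (W.baseChange K) (p ^ 1) e hμ hadd₁ hadd₂ hgal v).cupProduct x y))
  have hβ : ∀ (v : Place K) x y, β v x y = ZMod.ringEquivCongr (pow_one p)
      (inv v ((weilContPairingLocal (W.baseChange K) (p ^ 1) e hμ hadd₁ hadd₂ hgal v).cupProduct x y)) :=
    fun _ _ _ ↦ rfl
  -- additivity of `inv_v` and of the transport `ZMod (p ^ 1) ≃+* ZMod p` in the syntactic currency of the cup
  -- product (defeq bookkeeping, as in zhang3-p1's original: term-mode `map_add` ∕ `map_nsmul`)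
  have hinv_add_left : ∀ (v : Place K) (x x' y : galoisCohomology (((W.baseChange K).torsionGaloisModule ((p ^ 1 :
      ℕ) : ℤ)).toLocal v) 1),
      inv v ((weilContPairingLocal (W.baseChange K) (p ^ 1) e hμ hadd₁ hadd₂ hgal v).cupProduct x y +
          (weilContPairingLocal (W.baseChange K) (p ^ 1) e hμ hadd₁ hadd₂ hgal v).cupProduct x' y) = inv v
          ((weilContPairingLocal (W.baseChange K) (p ^ 1) e hμ hadd₁ hadd₂ hgal v).cupProduct x y) + inv v
          ((weilContPairingLocal (W.baseChange K) (p ^ 1) e hμ hadd₁ hadd₂ hgal v).cupProduct x' y) :=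
    fun v x x' y ↦ map_add _ _ _
  have hinv_add_right : ∀ (v : Place K) (x y y' : galoisCohomology (((W.baseChange K).torsionGaloisModule ((p ^ 1 :
      ℕ) : ℤ)).toLocal v) 1),
      inv v ((weilContPairingLocal (W.baseChange K) (p ^ 1) e hμ hadd₁ hadd₂ hgal v).cupProduct x y +
          (weilContPairingLocal (W.baseChange K) (p ^ 1) e hμ hadd₁ hadd₂ hgal v).cupProduct x y') = inv v
          ((weilContPairingLocal (W.baseChange K) (p ^ 1) e hμ hadd₁ hadd₂ hgal v).cupProduct x y) + inv v
          ((weilContPairingLocal (W.baseChange K) (p ^ 1) e hμ hadd₁ hadd₂ hgal v).cupProduct x y') :=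
    fun v x y y' ↦ map_add _ _ _
  have hinv_nsmul : ∀ (v : Place K) (k : ℕ) (x y : galoisCohomology (((W.baseChange K).torsionGaloisModule ((p ^ 1
      : ℕ) : ℤ)).toLocal v) 1),
      (inv v (k • (weilContPairingLocal (W.baseChange K) (p ^ 1) e hμ hadd₁ hadd₂ hgal v).cupProduct x y) :
          ZMod (p ^ 1)) = k • (inv v ((weilContPairingLocal (W.baseChange K) (p ^ 1) e hμ hadd₁ hadd₂ hgal v).cupProduct
          x y) : ZMod (p ^ 1)) :=
    fun v k x y ↦ map_nsmul _ _ _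
  have hcast_add : ∀ (s t : ZMod (p ^ 1)),
      ZMod.ringEquivCongr (pow_one p) (s + t) = ZMod.ringEquivCongr (pow_one p) s + ZMod.ringEquivCongr (pow_one p) t :=
    fun s t ↦ map_add _ _ _
  have hcast_nsmul : ∀ (k : ℕ) (s : ZMod (p ^ 1)),
      ZMod.ringEquivCongr (pow_one p) (k • s) = k • ZMod.ringEquivCongr (pow_one p) s :=
    fun k s ↦ map_nsmul _ _ _
  have hzmodF : ∀ (a t : ZMod p), a • t = a.val • t := fun a t ↦ hzmod a t
  refine ⟨fun v ↦ LinearMap.mk₂ (ZMod p) (β v)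
      (fun x x' y ↦ by rw [hβ, hβ, hβ, hadd_left, hinv_add_left, hcast_add])
      (fun a x y ↦ by rw [hβ, hβ, hzmod a x, hnsmul_left, hinv_nsmul, hcast_nsmul, hzmodF])
      (fun x y y' ↦ by rw [hβ, hβ, hβ, hadd_right, hinv_add_right, hcast_add])
      (fun a x y ↦ by rw [hβ, hβ, hzmod a y, hnsmul_right, hinv_nsmul, hcast_nsmul, hzmodF]), fun _ _ _ ↦ rfl⟩

variable {e hμ hadd₁ hadd₂ hgal inv}
  {b : (v : Place K) →
    galoisCohomology (((W.baseChange K).torsionGaloisModule ((p ^ 1 : ℕ) : ℤ)).toLocal v) 1 →ₗ[ZMod p]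
        galoisCohomology (((W.baseChange K).torsionGaloisModule ((p ^ 1 : ℕ) : ℤ)).toLocal v) 1 →ₗ[ZMod p] ZMod p}
  (hb : ∀ (v : Place K) x y,
    b v x y = ZMod.ringEquivCongr (pow_one p)
      (inv v ((weilContPairingLocal (W.baseChange K) (p ^ 1) e hμ hadd₁ hadd₂ hgal v).cupProduct x y)))

omit [W.IsGloballyMinimal] [Finite (geomTorsion (W.baseChange K) ((p ^ 1 : ℕ) : ℤ))] in
include hb in
/-- **(REC) for `b_v = inv_v ∘ ∪ₑ`**: Tate's reciprocity law for the Weil cup product on `E[p]` over the totally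
complex `K` (`sum_inv_weilCupProduct_localization_eq_zero`). [cite: MilneADT2006, Ch. I, Thm. 4.10]
[cite: CasselsFrohlichANT1967, Ch. VII §11] -/
theorem sum_invCupProduct_eq_zero_P (hPT : inv.SumLocalTermEqZero) (x y : Vp W K p) (T : Finset (Place K))
    (hT : ∀ v, v ∉ T →
      b v (galoisCohomology.localization ((W.baseChange K).torsionGaloisModule ((p ^ 1 : ℕ) : ℤ)) v 1 x)
        (galoisCohomology.localization ((W.baseChange K).torsionGaloisModule ((p ^ 1 : ℕ) : ℤ)) v 1 y) = 0) :
    ∑ v ∈ T, b v (galoisCohomology.localization ((W.baseChange K).torsionGaloisModule ((p ^ 1 : ℕ) : ℤ)) v 1 x)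
      (galoisCohomology.localization ((W.baseChange K).torsionGaloisModule ((p ^ 1 : ℕ) : ℤ)) v 1 y) = 0 := by
  have h := sum_inv_weilCupProduct_localization_eq_zero (W.baseChange K) (p ^ 1) e hμ hadd₁ hadd₂ hgal inv hPT
    x y T (fun v hv ↦ by
      have h' := hT v hv
      rw [hb] at h'
      exact (EmbeddingLike.map_eq_zero_iff (f := ZMod.ringEquivCongr (pow_one p))).mp h')
  simp only [hb]
  rw [← map_sum, h, map_zero]

omit [W.IsGloballyMinimal] [Finite (geomTorsion (W.baseChange K) ((p ^ 1 : ℕ) : ℤ))] in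
include hb in
/-- **Kummer isotropy of `b_v`** at every place (Poonen–Rains, DISCHARGED in the tree:
`kummerClass_cupProduct_kummerClass_eq_zero_holds`). [cite: PoonenRains2012, Prop. 4.8, Cor. 4.6] -/
theorem invCupProduct_eq_zero_of_mem_kummer_P (halt : ∀ Q, e Q Q = 1) (v : Place K) :
    ∀ x ∈ (W.baseChange K).kummerLocalConditionAt ((p ^ 1 : ℕ) : ℤ) (Place.Completion v),
    ∀ y ∈ (W.baseChange K).kummerLocalConditionAt ((p ^ 1 : ℕ) : ℤ) (Place.Completion v), b v x y = 0 := by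
  intro x hx y hy
  have hpZ : ((p ^ 1 : ℕ) : ℤ) ≠ 0 := by exact_mod_cast pow_ne_zero 1 (Fact.out : p.Prime).ne_zero
  have h0 : (weilContPairingLocal (W.baseChange K) (p ^ 1) e hμ hadd₁ hadd₂ hgal v).cupProduct x y = 0 := by
    exact (W.baseChange K).cupProduct_eq_zero_of_mem_kummerSelmerStructure_of_fact (p ^ 1) e hpZ v
      (kummerClass_cupProduct_kummerClass_eq_zero_holds _) hμ hadd₁ hadd₂ halt hgal hx hy
  rw [hb, h0]
  exact (congrArg (ZMod.ringEquivCongr (pow_one p)) (map_zero (inv v))).trans (map_zero _)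

include hb in
/-- **TORIC isotropy of `b_v` ABOVE A BERTOLINI–DARMON ADMISSIBLE PRIME** (`[K : ℚ] = 2`): two classes with TORIC
localisation at the place `v ∋ q` have cup product zero — their restrictions to `Γ_{K_v}` are represented by cocycles
valued in the augmentation line `(F − 1)E[p]`, of order `≤ p` (`natCard_augmentation_le_of_admQ`, `Frob_q² ≠ 1`), on
which the alternating Weil pairing vanishes (akr-p1 g2's `weilPairingHom_eq_zero_of_mem_of_card_le`,
`weilCupProduct_res_eq_zero_of_valued`). [cite: WZhang2014, Prop. 5.4] [cite: BertoliniDarmon2005, §2.2–§2.3] -/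
theorem invCupProduct_eq_zero_of_mem_toric_P (hK2 : Module.finrank ℚ K = 2) (halt : ∀ Q, e Q Q = 1)
    (q : AdmQ W K p) (v : HeightOneSpectrum (𝓞 K)) (hqv : ((q : ℕ) : 𝓞 K) ∈ v.asIdeal) (x y : Vp W K p)
    (hx : x ∈ toricLocalKer (W.baseChange K) (v.adicCompletion K) ((p ^ 1 : ℕ) : ℤ))
    (hy : y ∈ toricLocalKer (W.baseChange K) (v.adicCompletion K) ((p ^ 1 : ℕ) : ℤ)) :
    b (Sum.inr v)
      (galoisCohomology.localization ((W.baseChange K).torsionGaloisModule ((p ^ 1 : ℕ) : ℤ)) (Sum.inr v) 1 x)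
      (galoisCohomology.localization ((W.baseChange K).torsionGaloisModule ((p ^ 1 : ℕ) : ℤ)) (Sum.inr v) 1 y)
        = 0 := by
  haveI : Fact (Nat.Prime (p ^ 1)) := ⟨by rw [pow_one]; exact Fact.out⟩
  -- the binder instance at the place `Sum.inr v`, in `adicCompletion` spelling
  haveI : CompactSpace (absoluteGaloisGroup (v.adicCompletion K)) :=
    ‹∀ v : Place K, CompactSpace (absoluteGaloisGroup (Place.Completion v))› (Sum.inr v)
  have h0 : (weilContPairingLocal (W.baseChange K) (p ^ 1) e hμ hadd₁ hadd₂ hgal (Sum.inr v)).cupProduct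
      (galoisCohomology.localization ((W.baseChange K).torsionGaloisModule ((p ^ 1 : ℕ) : ℤ)) (Sum.inr v) 1 x)
      (galoisCohomology.localization ((W.baseChange K).torsionGaloisModule ((p ^ 1 : ℕ) : ℤ)) (Sum.inr v) 1 y)
        = 0 :=
    weilCupProduct_res_eq_zero_of_valued (W.baseChange K) (p ^ 1) (v.adicCompletion K) e hμ hadd₁ hadd₂ hgal _
      (fun S hS T hT ↦ weilPairingHom_eq_zero_of_mem_of_card_le (W.baseChange K) (p ^ 1) e hμ hadd₁ hadd₂ halt _
        (natCard_augmentation_le_of_admQ W K p hK2 q v hqv) S T hS hT)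
      (exists_valued_cocycle_of_mem_toricLocalKer (W.baseChange K) (p ^ 1) (v.adicCompletion K) hx)
      (exists_valued_cocycle_of_mem_toricLocalKer (W.baseChange K) (p ^ 1) (v.adicCompletion K) hy)
  rw [hb, h0]
  exact (congrArg (ZMod.ringEquivCongr (pow_one p)) (map_zero (inv (Sum.inr v)))).trans (map_zero _)

end Package

/-! ## §2 Stub LOC reduced to the Kolyvagin-prime package + (Supply) -/

/-- **`KolyvaginLocalPackageP` from the Kolyvagin-prime local package + (Line) + (Supply)** at an imaginary quadratic
`K`. Hypotheses, all LOCAL AT KOLYVAGIN PRIMES `λ` or (Supply): (Tr-iso) `hisoTr` — the transverse condition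
`transverseLocalKerP` is isotropic for the local Weil cup product, for every Weil-type pairing `e` on `E[p]`; (Perf)
`hperf` — the cup product of a Kummer `s`-eigenclass non-zero at `λ` and a transverse `s`-eigenclass non-zero at `λ` is
non-zero, for every Weil pairing; (Line) `hline` — the Kummer eigen-line (in the `galoisCohomology.localization` model,
integer multiples); (Supply) `hSupply` — W. Zhang's Lemma 8.2 for the level structure (verbatim the field `supply`).
SUPPLIED IN THE KERNEL: `b_v := inv_v ∘ (· ∪_e ·)` for a Weil pairing `e` and the Poitou–Tate family `inv` of the
totally complex `K`, (REC), the Kummer isotropy at every place, the TORIC isotropy above every admissible prime.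
[cite: WZhang2014, §8.1, Lemma 8.1, Lemma 8.2, Prop. 5.4] [cite: MilneADT2006, Ch. I, Cor. 2.3, Thm. 4.10]
[cite: PoonenRains2012, Prop. 4.10] -/
theorem kolyvaginLocalPackageP_of_kolyvaginPrimePackage (hK : IsImaginaryQuadratic K)
    -- (Tr-iso): the transverse condition is isotropic for the local Weil cup product, for every Weil-type pairing
    (hisoTr : ∀ (e : geomTorsion (W.baseChange K) ((p ^ 1 : ℕ) : ℤ) → geomTorsion (W.baseChange K) ((p ^ 1 : ℕ) : ℤ) →
        AlgebraicClosure K)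
      (hμ : ∀ P Q, e P Q ^ (p ^ 1) = 1) (hadd₁ : ∀ P₁ P₂ Q, e (P₁ + P₂) Q = e P₁ Q * e P₂ Q)
      (hadd₂ : ∀ P Q₁ Q₂, e P (Q₁ + Q₂) = e P Q₁ * e P Q₂)
      (hgal : ∀ (σ : absoluteGaloisGroup K) (P Q : geomTorsion (W.baseChange K) ((p ^ 1 : ℕ) : ℤ)),
        σ • e P Q = e (σ • P) (σ • Q))
      (ℓ : ℕ), Zhang2014.IsKolyvaginPrime (W.conductorNorm ℤ) W K p ℓ →
      ∀ (v : HeightOneSpectrum (𝓞 K)), ((ℓ : ℕ) : 𝓞 K) ∈ v.asIdeal → ∀ (x y : Vp W K p),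
      x ∈ transverseLocalKerP W K p ι ℓ v → y ∈ transverseLocalKerP W K p ι ℓ v →
      (weilContPairingLocal (W.baseChange K) (p ^ 1) e hμ hadd₁ hadd₂ hgal (Sum.inr v)).cupProduct
        (galoisCohomology.localization ((W.baseChange K).torsionGaloisModule ((p ^ 1 : ℕ) : ℤ)) (Sum.inr v) 1 x)
        (galoisCohomology.localization ((W.baseChange K).torsionGaloisModule ((p ^ 1 : ℕ) : ℤ)) (Sum.inr v) 1 y)
          = 0)
    -- (Perf): Kummer^s × transverse^s is non-degenerate at Kolyvagin primes, for every Weil pairing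
    (hperf : ∀ (e : geomTorsion (W.baseChange K) ((p ^ 1 : ℕ) : ℤ) → geomTorsion (W.baseChange K) ((p ^ 1 : ℕ) : ℤ) →
        AlgebraicClosure K)
      (hμ : ∀ P Q, e P Q ^ (p ^ 1) = 1) (hadd₁ : ∀ P₁ P₂ Q, e (P₁ + P₂) Q = e P₁ Q * e P₂ Q)
      (hadd₂ : ∀ P Q₁ Q₂, e P (Q₁ + Q₂) = e P Q₁ * e P Q₂) (_halt : ∀ Q, e Q Q = 1)
      (_hnondeg : ∀ Q, (∀ P, e P Q = 1) → Q = 0)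
      (hgal : ∀ (σ : absoluteGaloisGroup K) (P Q : geomTorsion (W.baseChange K) ((p ^ 1 : ℕ) : ℤ)),
        σ • e P Q = e (σ • P) (σ • Q))
      (ℓ : ℕ), Zhang2014.IsKolyvaginPrime (W.conductorNorm ℤ) W K p ℓ →
      ∀ (v : HeightOneSpectrum (𝓞 K)), ((ℓ : ℕ) : 𝓞 K) ∈ v.asIdeal → ∀ (s : Bool) (x y : Vp W K p),
      conjAct W c ((p ^ 1 : ℕ) : ℤ) x = sgnP s • x → conjAct W c ((p ^ 1 : ℕ) : ℤ) y = sgnP s • y →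
      x ∈ selmerLocalKer (W.baseChange K) (v.adicCompletion K) ((p ^ 1 : ℕ) : ℤ) →
      x ∉ (W.baseChange K).torsionLocalKer (v.adicCompletion K) ((p ^ 1 : ℕ) : ℤ) →
      y ∈ transverseLocalKerP W K p ι ℓ v →
      y ∉ (W.baseChange K).torsionLocalKer (v.adicCompletion K) ((p ^ 1 : ℕ) : ℤ) →
      (weilContPairingLocal (W.baseChange K) (p ^ 1) e hμ hadd₁ hadd₂ hgal (Sum.inr v)).cupProduct
        (galoisCohomology.localization ((W.baseChange K).torsionGaloisModule ((p ^ 1 : ℕ) : ℤ)) (Sum.inr v) 1 x)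
        (galoisCohomology.localization ((W.baseChange K).torsionGaloisModule ((p ^ 1 : ℕ) : ℤ)) (Sum.inr v) 1 y)
          ≠ 0)
    -- (Line): the Kummer eigen-line at a Kolyvagin prime
    (hline : ∀ (ℓ : ℕ), Zhang2014.IsKolyvaginPrime (W.conductorNorm ℤ) W K p ℓ →
      ∀ (v : HeightOneSpectrum (𝓞 K)), ((ℓ : ℕ) : 𝓞 K) ∈ v.asIdeal → ∀ (s : Bool),
      ∃ e' : galoisCohomology (((W.baseChange K).torsionGaloisModule ((p ^ 1 : ℕ) : ℤ)).toLocal (Sum.inr v)) 1,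
      ∀ x : Vp W K p, conjAct W c ((p ^ 1 : ℕ) : ℤ) x = sgnP s • x →
        x ∈ selmerLocalKer (W.baseChange K) (v.adicCompletion K) ((p ^ 1 : ℕ) : ℤ) →
        ∃ a : ℤ, galoisCohomology.localization ((W.baseChange K).torsionGaloisModule ((p ^ 1 : ℕ) : ℤ))
          (Sum.inr v) 1 x = a • e')
    -- (Supply): Zhang's Lemma 8.2 for the level-n structure (verbatim the field `supply`)
    (hSupply : ∀ (n : Finset (AdmQ W K p)), n.Nonempty →
      ∀ (ℓ : {ℓ // Zhang2014.IsKolyvaginPrime (W.conductorNorm ℤ) W K p ℓ})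
        (T : Finset {ℓ // Zhang2014.IsKolyvaginPrime (W.conductorNorm ℤ) W K p ℓ}), ℓ ∉ T →
      ∀ s : Bool, ∃ x : Vp W K p, conjAct W c ((p ^ 1 : ℕ) : ℤ) x = sgnP s • x ∧ x ≠ 0 ∧
        (∀ w : InfinitePlace K, x ∈ selmerLocalKer (W.baseChange K) w.Completion ((p ^ 1 : ℕ) : ℤ)) ∧
        (∀ v : HeightOneSpectrum (𝓞 K), ((ℓ : ℕ) : 𝓞 K) ∉ v.asIdeal →
          (∀ ℓ' ∈ T, ((ℓ' : ℕ) : 𝓞 K) ∉ v.asIdeal) →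
          ((∀ q ∈ n, ((q : ℕ) : 𝓞 K) ∉ v.asIdeal) →
            x ∈ selmerLocalKer (W.baseChange K) (v.adicCompletion K) ((p ^ 1 : ℕ) : ℤ)) ∧
          (∀ q ∈ n, ((q : ℕ) : 𝓞 K) ∈ v.asIdeal →
            x ∈ toricLocalKer (W.baseChange K) (v.adicCompletion K) ((p ^ 1 : ℕ) : ℤ))) ∧
        (∀ ℓ' ∈ T, ∀ v : HeightOneSpectrum (𝓞 K), ((ℓ' : ℕ) : 𝓞 K) ∈ v.asIdeal →
          x ∈ transverseLocalKerP W K p ι ℓ' v)) :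
    Nonempty (KolyvaginLocalPackageP W K p ι c) := by
  have hp : p.Prime := Fact.out
  haveI : IsTotallyComplex K := hK.2
  -- a Weil pairing on `E[p]`, the Poitou–Tate family of the totally complex `K`, the local forms
  obtain ⟨e, hμ, hadd₁, hadd₂, halt, hnondeg, hgal⟩ :=
    exists_weilPairing_holds (W.baseChange K) (p ^ 1) (by rw [pow_one]; exact hp.two_le) (by
      rw [pow_one]; exact_mod_cast hp.ne_zero)
  obtain ⟨inv, hinvperf, hPT⟩ := poitouTate_sum_localTatePairing_eq_zero_of_isTotallyComplex K (p ^ 1)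
  obtain ⟨b, hb⟩ := exists_zmodBilinear_invCupProduct_P W K p e hμ hadd₁ hadd₂ hgal inv
  have hinj : ∀ v : HeightOneSpectrum (𝓞 K), Function.Injective (inv (Sum.inr v)) := fun v ↦ (hinvperf v).1.1
  refine ⟨{
    b := b
    reciprocity := fun x y T hT ↦ sum_invCupProduct_eq_zero_P W K p hb hPT x y T hT
    isoKummer := fun v ↦ invCupProduct_eq_zero_of_mem_kummer_P W K p hb halt v
    isoToric := fun q v hqv x y hx hy ↦ invCupProduct_eq_zero_of_mem_toric_P W K p hb hK.1 halt q v hqv x y hx hy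
    isoTransverse := fun ℓ hℓ v hv x y hx hy ↦ by
      rw [hb, hisoTr e hμ hadd₁ hadd₂ hgal ℓ hℓ v hv x y hx hy]
      exact (congrArg (ZMod.ringEquivCongr (pow_one p)) (map_zero (inv (Sum.inr v)))).trans (map_zero _)
    perf := fun ℓ hℓ v hv s x y hxs hys hxK hx0 hyT hy0 h ↦ by
      rw [hb] at h
      have h' := (EmbeddingLike.map_eq_zero_iff (f := ZMod.ringEquivCongr (pow_one p))).mp h
      exact hperf e hμ hadd₁ hadd₂ halt hnondeg hgal ℓ hℓ v hv s x y hxs hys hxK hx0 hyT hy0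
        (hinj _ (h'.trans (map_zero _).symm))
    line := fun ℓ hℓ v hv s ↦ by
      obtain ⟨e', he'⟩ := hline ℓ hℓ v hv s
      refine ⟨e', fun x hxs hxK ↦ ?_⟩
      obtain ⟨a, ha⟩ := he' x hxs hxK
      exact ⟨(a : ZMod p), by rw [ha, Int.cast_smul_eq_zsmul]⟩
    supply := hSupply }⟩

end Summit.BirchSwinnertonDyer.BirchSwinnertonDyer.Theorems.AdditiveKoly

end
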